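import Literature.MathematicalPhysics.QuantumFieldTheory.PeriodicBoxRooting
import Literature.MathematicalPhysics.QuantumFieldTheory.PeriodicBoxInclusion
import Literature.MathematicalPhysics.QuantumFieldTheory.PlaqSystemLogZAnalytic
import HarnessLib

/-!
# The strong-coupling free energy of the Wilson theory on tubes and tori at complex coupling: truncation

For the Wilson lattice gauge theory with compact structure group `G` and continuous matrix
representation `ρ` on the four-dimensional periodic boxes `L³ × t` (tubes) and `P⁴` (symmetric tori)
— the box plaquette systems `boxSystem ρ ![L,L,L,t]`, `boxSystem ρ ![P,P,P,P]` of
`PeriodicBoxPlaqSystem` — the Kotecký–Preiss logarithm `log Z` of the complex-coupling partition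
function (`PlaqSystemClusterExpansion`: the tree's `pertLogZ`) satisfies, on the strong-coupling disc
`‖z‖ M ≤ 1`, `e² (2M‖z‖) (D+1)² ≤ 1/2` (`M = costBound ρ`, `D = boxDeg 4`):

* `norm_pertLogZ_tube_sub_mul_le`: `‖log Z(L³×t) - t·E_m‖ ≤ 6L³t e^{-m}` for `2m ≤ t`, `m+1 ≤ t`, where
  `E_m` (the time-rooted small-cluster sum of the reference tube `L³×(m+1)`) does not depend on `t`;
* `norm_pertLogZ_cube_sub_mul_le`: `‖log Z(P⁴) - P⁴·F_m‖ ≤ 6P⁴ e^{-m}` likewise, with the fully rooted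
  small-cluster sum `F_m` of the reference cube `(m+1)⁴`.

Ingredients: the tail of the cluster expansion (`PlaqSystem.norm_pertLogZ_sub_sum_small_le`), the
factor of the volume by rooting (`sum_small_eq_size_mul_sum_boxRooted` of `PeriodicBoxRooting`, here
in the instance-robust form `sum_small_eq_size_mul_sum_of_iff`), and the independence of the rooted
small clusters of the sizes (`sum_small_boxRooted_eq_of_le` of `PeriodicBoxInclusion`). Also: the
label count `card_boxLabel_four`, the size vectors, and a uniform-limit lemma
`exists_tendstoUniformlyOn_of_cauchy_bound` used by the sequel `PeriodicBoxFreeEnergyLimits`.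
Everything is proved; no named facts; no new definitions.

## References

* E. Seiler, LNP 159 (1982), Ch. 3 (the strong-coupling expansion of the free energy).
  [SeilerLNP1982]
* K. Osterwalder, E. Seiler, Ann. Phys. 110 (1978) 440–471, §3, Thm. 3.7. [OsterwalderSeilerAnnPhys1978]
* R. Kotecký, D. Preiss, Comm. Math. Phys. 103 (1986) 491–498. [KoteckyPreiss1986]
-/

noncomputable section

namespace Literature.MathematicalPhysics.QuantumFieldTheory

open MeasureTheory Finset Filter Topology
open Literature.Probability.LatticeModels

/-! ### Counting labels -/

/-- The number of labels of the box of sizes `n`: `(∏ nᵢ) · #BoxPair d`. [folklore] -/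
theorem card_boxLabel {d : ℕ} (n : Fin d → ℕ) :
    Fintype.card (BoxLabel n) = (∏ i, n i) * Fintype.card (BoxPair d) := by
  rw [Fintype.card_prod, Fintype.card_pi]
  simp only [Fintype.card_fin]

/-- There are six planes in four dimensions. [folklore] -/
theorem card_boxPair_four : Fintype.card (BoxPair 4) = 6 := by decide

/-- The number of labels of the four-dimensional box `n₀ × n₁ × n₂ × n₃`: `6 n₀ n₁ n₂ n₃`. [folklore] -/
theorem card_boxLabel_four (n₀ n₁ n₂ n₃ : ℕ) :
    Fintype.card (BoxLabel ![n₀, n₁, n₂, n₃]) = n₀ * n₁ * n₂ * n₃ * 6 := by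
  rw [card_boxLabel, card_boxPair_four, Fin.prod_univ_four]
  rfl

/-! ### Uniform limits from a Cauchy estimate -/

/-- **A uniform Cauchy estimate gives a uniform limit with the same rate.** If
`‖u k z - u k' z‖ ≤ b N` for `N ≤ k, k'` and `z ∈ K`, with `b → 0`, then there is `g` with
`‖u k z - g z‖ ≤ b k` on `K` and `u → g` uniformly on `K`. [folklore] -/
theorem exists_tendstoUniformlyOn_of_cauchy_bound {u : ℕ → ℂ → ℂ} {K : Set ℂ} {b : ℕ → ℝ}
    (hb : Tendsto b atTop (𝓝 0))
    (hu : ∀ z ∈ K, ∀ N k k', N ≤ k → N ≤ k' → ‖u k z - u k' z‖ ≤ b N) :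
    ∃ g : ℂ → ℂ, (∀ z ∈ K, ∀ k, ‖u k z - g z‖ ≤ b k) ∧ TendstoUniformlyOn u g atTop K := by
  set g : ℂ → ℂ := fun z => limUnder atTop fun k => u k z with hg
  have hcauchy : ∀ z ∈ K, CauchySeq fun k => u k z := fun z hz =>
    cauchySeq_of_le_tendsto_0 b (fun k k' N hk hk' => by
      rw [dist_eq_norm]; exact hu z hz N k k' hk hk') hb
  have htend : ∀ z ∈ K, Tendsto (fun k => u k z) atTop (𝓝 (g z)) := fun z hz => (hcauchy z hz).tendsto_limUnder
  have hbound : ∀ z ∈ K, ∀ k, ‖u k z - g z‖ ≤ b k := by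
    intro z hz k
    refine le_of_tendsto ((tendsto_const_nhds.sub (htend z hz)).norm) ?_
    filter_upwards [eventually_ge_atTop k] with k' hk'
    exact hu z hz k k k' le_rfl hk'
  refine ⟨g, hbound, Metric.tendstoUniformlyOn_iff.2 fun ε hε => ?_⟩
  filter_upwards [hb.eventually (gt_mem_nhds hε)] with k hk z hz
  rw [dist_comm, dist_eq_norm]
  exact lt_of_le_of_lt (hbound z hz k) hk

/-- The geometric rate `e^{-⌊(k+1)/2⌋}` tends to zero. [folklore] -/
theorem tendsto_exp_neg_half_floor (c : ℝ) :
    Tendsto (fun k : ℕ => c * Real.exp (-(((k + 1) / 2 : ℕ) : ℝ))) atTop (𝓝 0) := by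
  have h : Tendsto (fun k : ℕ => (((k + 1) / 2 : ℕ) : ℝ)) atTop atTop := by
    refine tendsto_natCast_atTop_atTop.comp ?_
    refine Filter.tendsto_atTop_atTop.2 fun b => ⟨2 * b, fun k hk => ?_⟩
    omega
  have := (Real.tendsto_exp_neg_atTop_nhds_zero.comp h).const_mul c
  simpa using this

/-- Monotonicity of the rate in the index. [folklore] -/
theorem exp_neg_floor_half_le {N k : ℕ} (h : N ≤ k) :
    Real.exp (-((k / 2 : ℕ) : ℝ)) ≤ Real.exp (-((N / 2 : ℕ) : ℝ)) := by
  apply Real.exp_le_exp.2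
  have : N / 2 ≤ k / 2 := Nat.div_le_div_right h
  have : ((N / 2 : ℕ) : ℝ) ≤ ((k / 2 : ℕ) : ℝ) := by exact_mod_cast this
  linarith

/-! ### The strong-coupling disc -/

/-- On the disc `‖z‖ ≤ r` with `r M ≤ 1` and `e² (2Mr) (D+1)² ≤ 1/2`, the hypotheses of the cluster
expansion hold at `z`. [folklore] -/
theorem disc_hypotheses {M r : ℝ} (hM : 0 < M) {D : ℕ} (hrM : r * M ≤ 1)
    (hr2 : Real.exp 2 * (2 * M * r) * ((D : ℝ) + 1) ^ 2 ≤ 1 / 2) {z : ℂ} (hz : ‖z‖ ≤ r) :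
    ‖z‖ * M ≤ 1 ∧ Real.exp 2 * (2 * M * ‖z‖) * ((D : ℝ) + 1) ^ 2 ≤ 1 / 2 ∧
      Real.exp 1 * (2 * M * ‖z‖) * ((D : ℝ) + 1) ^ 2 ≤ 1 / 2 := by
  have h1 : ‖z‖ * M ≤ 1 := le_trans (by gcongr) hrM
  have h2 : Real.exp 2 * (2 * M * ‖z‖) * ((D : ℝ) + 1) ^ 2 ≤ 1 / 2 := le_trans (by gcongr) hr2
  exact ⟨h1, h2, PlaqSystem.smallness_one_of_two (by positivity) h2⟩

/-! ### The four-dimensional boxes: sizes -/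

/-- Componentwise comparison of tube sizes. [folklore] -/
theorem tube_sizes_le {a t t' : ℕ} (h : t ≤ t') : ∀ i : Fin 4, (![a, a, a, t] : Fin 4 → ℕ) i ≤ ![a, a, a, t'] i := by
  intro i; fin_cases i <;> simp [h]

/-- Tube sizes agree outside the time direction `3`. [folklore] -/
theorem tube_sizes_eq_of_ne {a t t' : ℕ} : ∀ i : Fin 4, i ∉ ({3} : Finset (Fin 4)) →
    (![a, a, a, t] : Fin 4 → ℕ) i = ![a, a, a, t'] i := by
  intro i hi; fin_cases i <;> simp_all

/-- Positivity of tube sizes. [folklore] -/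
theorem tube_sizes_pos {a t : ℕ} (ha : 0 < a) (ht : 0 < t) : ∀ i : Fin 4, 0 < (![a, a, a, t] : Fin 4 → ℕ) i := by
  intro i; fin_cases i <;> simp [ha, ht]

/-- Componentwise comparison of cube sizes. [folklore] -/
theorem cube_sizes_le {P P' : ℕ} (h : P ≤ P') : ∀ i : Fin 4, (![P, P, P, P] : Fin 4 → ℕ) i ≤ ![P', P', P', P'] i := by
  intro i; fin_cases i <;> simp [h]

/-- Positivity of cube sizes. [folklore] -/
theorem cube_sizes_pos {P : ℕ} (hP : 0 < P) : ∀ i : Fin 4, 0 < (![P, P, P, P] : Fin 4 → ℕ) i := by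
  intro i; fin_cases i <;> simp [hP]

/-- All entries of a cube size vector. [folklore] -/
theorem cube_sizes_apply (P : ℕ) (i : Fin 4) : (![P, P, P, P] : Fin 4 → ℕ) i = P := by
  fin_cases i <;> rfl

/-! ### The truncated cluster expansion of `log Z` on tubes and tori -/

section Boxes

variable {G : Type*} [Group G] [TopologicalSpace G] [IsTopologicalGroup G] [CompactSpace G]
  [MeasurableSpace G] [BorelSpace G] {N : ℕ} {ρ : G →* Matrix (Fin N) (Fin N) ℂ}

/-- Sums over filters with equivalent predicates agree, whatever the decidability instances.
[folklore] -/
theorem sum_filter_congr_prop {α M : Type*} [AddCommMonoid M] {s : Finset α} {p q : α → Prop}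
    {hp : DecidablePred p} {hq : DecidablePred q} (h : ∀ x ∈ s, (p x ↔ q x)) (f : α → M) :
    ∑ x ∈ @Finset.filter α p hp s, f x = ∑ x ∈ @Finset.filter α q hq s, f x := by
  rw [Finset.filter_congr h]

/-- One rooting step on a box of sizes `n`, in a form robust to the spelling of the predicates and
to the decidability instances: for `Q` translation invariant in the direction `i` and
`Q' ↔ Q ∧ rooted in i`, `Σ_{small, Q} Φ^T = nᵢ · Σ_{small, Q'} Φ^T`. [cite: SeilerLNP1982, Ch. 2] -/
theorem sum_small_eq_size_mul_sum_of_iff {n : Fin 4 → ℕ} (hρ : Continuous ρ) {z : ℂ}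
    (hzM : ‖z‖ * costBound ρ ≤ 1)
    (hz1 : Real.exp 1 * (2 * costBound ρ * ‖z‖) * ((boxDeg 4 : ℝ) + 1) ^ 2 ≤ 1 / 2)
    (i : Fin 4) {m : ℕ} (hm : 2 * m ≤ n i) (Q Q' : Finset (Finset (BoxLabel n)) → Prop)
    [DecidablePred Q] [DecidablePred Q']
    (hQ : ∀ (s : ℕ) (𝒞 : Finset (Finset (BoxLabel n))), Q (𝒞.image (Finset.image (BoxLabel.rot i s))) ↔ Q 𝒞)
    (hQ' : ∀ 𝒞, Q' 𝒞 ↔ Q 𝒞 ∧ BoxRooted i m 𝒞) :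
    ∑ 𝒞 ∈ ((rconnSubsets (boxSystem (G := G) ρ n).Adj Finset.univ).powerset.filter
        fun 𝒞 => ∑ Y ∈ 𝒞, (Y.card : ℝ) < m) with Q 𝒞,
        truncatedWeight (GeomInc (boxSystem (G := G) ρ n).Adj)
          (connActivity (boxSystem (G := G) ρ n).Adj (zdHaar 4 G) ((boxSystem (G := G) ρ n).weight z)) 𝒞 =
      (n i : ℂ) * ∑ 𝒞 ∈ ((rconnSubsets (boxSystem (G := G) ρ n).Adj Finset.univ).powerset.filter
        fun 𝒞 => ∑ Y ∈ 𝒞, (Y.card : ℝ) < m) with Q' 𝒞,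
        truncatedWeight (GeomInc (boxSystem (G := G) ρ n).Adj)
          (connActivity (boxSystem (G := G) ρ n).Adj (zdHaar 4 G) ((boxSystem (G := G) ρ n).weight z)) 𝒞 := by
  classical
  have h1 := sum_small_eq_size_mul_sum_boxRooted (d := 4) (G := G) hρ hzM hz1 i hm Q hQ
  refine (sum_filter_congr_prop (fun _ _ => Iff.rfl) _).trans
    (h1.trans (congrArg (fun x => ((n i : ℕ) : ℂ) * x) ?_))
  exact sum_filter_congr_prop (fun 𝒞 _ => (hQ' 𝒞).symm) _

open scoped Classical in
/-- **Tubes: `log Z(L³ × t) = t · E_m + O(L³ t e^{-m})`.** On the strong-coupling disc, for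
`2m ≤ t` and `m + 1 ≤ t`, the Kotecký–Preiss logarithm of the Wilson partition function of the tube
`a³ × t` differs from `t` times the rooted small-cluster sum `E_m` of the reference tube `a³ × (m+1)`
by at most `6a³t · e^{-m}` (tail of the cluster expansion; translation invariance in the time
direction; independence of the rooted small clusters of the length). [cite: SeilerLNP1982, Ch. 3] -/
theorem norm_pertLogZ_tube_sub_mul_le (hρ : Continuous ρ) {z : ℂ} (hzM : ‖z‖ * costBound ρ ≤ 1)
    (hz2 : Real.exp 2 * (2 * costBound ρ * ‖z‖) * ((boxDeg 4 : ℝ) + 1) ^ 2 ≤ 1 / 2)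
    {a t m : ℕ} (ha : 0 < a) (h2m : 2 * m ≤ t) (hm1 : m + 1 ≤ t) :
    ‖pertLogZ (zdHaar 4 G) ((boxSystem (G := G) ρ (![a, a, a, t] : Fin 4 → ℕ)).weight z)
        (boxSystem (G := G) ρ (![a, a, a, t] : Fin 4 → ℕ)).Adj Finset.univ -
      (t : ℂ) * ∑ 𝒞 ∈ ((rconnSubsets (boxSystem (G := G) ρ (![a, a, a, m + 1] : Fin 4 → ℕ)).Adj
          Finset.univ).powerset.filter fun 𝒞 => ∑ Y ∈ 𝒞, (Y.card : ℝ) < m) with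
            ∀ j ∈ ({3} : Finset (Fin 4)), BoxRooted j m 𝒞,
        truncatedWeight (GeomInc (boxSystem (G := G) ρ (![a, a, a, m + 1] : Fin 4 → ℕ)).Adj)
          (connActivity (boxSystem (G := G) ρ (![a, a, a, m + 1] : Fin 4 → ℕ)).Adj (zdHaar 4 G)
            ((boxSystem (G := G) ρ (![a, a, a, m + 1] : Fin 4 → ℕ)).weight z)) 𝒞‖ ≤
      (a * a * a * t * 6 : ℝ) * Real.exp (-(m : ℝ)) := by
  set nt : Fin 4 → ℕ := ![a, a, a, t] with hnt
  set nr : Fin 4 → ℕ := ![a, a, a, m + 1] with hnr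
  have hR := boxSystem_regular (d := 4) (G := G) ρ hρ nt
  have hz1 := PlaqSystem.smallness_one_of_two (D := boxDeg 4) (by have := costBound_pos ρ; positivity) hz2
  have hsmall1 : Real.exp 1 * (2 * costBound ρ * ‖z‖) * ((boxDeg 4 : ℝ) + 1) ^ 2 ≤ 1 / 2 := by
    simpa [mul_comm] using hz1
  -- tail of the cluster expansion
  have htail := PlaqSystem.norm_pertLogZ_sub_sum_small_le hR hzM hz2 Finset.univ m
  rw [Finset.card_univ, hnt, card_boxLabel_four] at htail
  -- translation invariance in the time direction
  have hnt3 : 2 * m ≤ nt 3 := h2m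
  have hrot := sum_small_eq_size_mul_sum_of_iff (G := G) (n := nt) hρ hzM hsmall1 (3 : Fin 4) hnt3
    (fun _ => True) (fun 𝒞 => ∀ j ∈ ({3} : Finset (Fin 4)), BoxRooted j m 𝒞) (fun _ _ => Iff.rfl)
    (fun 𝒞 => by simp)
  have ht : ((nt 3 : ℕ) : ℂ) = (t : ℂ) := rfl
  rw [Finset.filter_true, ht] at hrot
  -- independence of the length
  have hincl : ∑ 𝒞 ∈ ((rconnSubsets (boxSystem (G := G) ρ nr).Adj Finset.univ).powerset.filter
        fun 𝒞 => ∑ Y ∈ 𝒞, (Y.card : ℝ) < m) with ∀ j ∈ ({3} : Finset (Fin 4)), BoxRooted j m 𝒞,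
        truncatedWeight (GeomInc (boxSystem (G := G) ρ nr).Adj)
          (connActivity (boxSystem (G := G) ρ nr).Adj (zdHaar 4 G) ((boxSystem (G := G) ρ nr).weight z)) 𝒞 =
      ∑ 𝒞 ∈ ((rconnSubsets (boxSystem (G := G) ρ nt).Adj Finset.univ).powerset.filter
        fun 𝒞 => ∑ Y ∈ 𝒞, (Y.card : ℝ) < m) with ∀ j ∈ ({3} : Finset (Fin 4)), BoxRooted j m 𝒞,
        truncatedWeight (GeomInc (boxSystem (G := G) ρ nt).Adj)
          (connActivity (boxSystem (G := G) ρ nt).Adj (zdHaar 4 G) ((boxSystem (G := G) ρ nt).weight z)) 𝒞 :=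
    sum_small_boxRooted_eq_of_le (d := 4) (G := G) hρ (tube_sizes_le hm1) ({3} : Finset (Fin 4))
      tube_sizes_eq_of_ne (m := m) (fun i hi => by rw [Finset.mem_singleton.1 hi]; exact le_rfl)
      (tube_sizes_pos ha (Nat.succ_pos m)) z
  rw [← hincl] at hrot
  rw [← hrot]
  simpa using htail

open scoped Classical in
/-- **Tori: `log Z(P⁴) = P⁴ · F_m + O(P⁴ e^{-m})`.** On the strong-coupling disc, for `2m ≤ P` and
`m + 1 ≤ P`, the Kotecký–Preiss logarithm of the Wilson partition function of the symmetric torus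
`P⁴` differs from `P⁴` times the fully rooted small-cluster sum `F_m` of the reference cube
`(m+1)⁴` by at most `6P⁴ · e^{-m}`. [cite: SeilerLNP1982, Ch. 3] -/
theorem norm_pertLogZ_cube_sub_mul_le (hρ : Continuous ρ) {z : ℂ} (hzM : ‖z‖ * costBound ρ ≤ 1)
    (hz2 : Real.exp 2 * (2 * costBound ρ * ‖z‖) * ((boxDeg 4 : ℝ) + 1) ^ 2 ≤ 1 / 2)
    {P m : ℕ} (h2m : 2 * m ≤ P) (hm1 : m + 1 ≤ P) :
    ‖pertLogZ (zdHaar 4 G) ((boxSystem (G := G) ρ (![P, P, P, P] : Fin 4 → ℕ)).weight z)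
        (boxSystem (G := G) ρ (![P, P, P, P] : Fin 4 → ℕ)).Adj Finset.univ -
      (P : ℂ) ^ 4 * ∑ 𝒞 ∈ ((rconnSubsets (boxSystem (G := G) ρ
          (![m + 1, m + 1, m + 1, m + 1] : Fin 4 → ℕ)).Adj Finset.univ).powerset.filter
            fun 𝒞 => ∑ Y ∈ 𝒞, (Y.card : ℝ) < m) with ∀ j ∈ (Finset.univ : Finset (Fin 4)), BoxRooted j m 𝒞,
        truncatedWeight (GeomInc (boxSystem (G := G) ρ (![m + 1, m + 1, m + 1, m + 1] : Fin 4 → ℕ)).Adj)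
          (connActivity (boxSystem (G := G) ρ (![m + 1, m + 1, m + 1, m + 1] : Fin 4 → ℕ)).Adj (zdHaar 4 G)
            ((boxSystem (G := G) ρ (![m + 1, m + 1, m + 1, m + 1] : Fin 4 → ℕ)).weight z)) 𝒞‖ ≤
      ((P : ℝ) ^ 4 * 6) * Real.exp (-(m : ℝ)) := by
  set nP : Fin 4 → ℕ := ![P, P, P, P] with hnP
  set nr : Fin 4 → ℕ := ![m + 1, m + 1, m + 1, m + 1] with hnr
  have hR := boxSystem_regular (d := 4) (G := G) ρ hρ nP
  have hz1 := PlaqSystem.smallness_one_of_two (D := boxDeg 4) (by have := costBound_pos ρ; positivity) hz2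
  have hsmall1 : Real.exp 1 * (2 * costBound ρ * ‖z‖) * ((boxDeg 4 : ℝ) + 1) ^ 2 ≤ 1 / 2 := by
    simpa [mul_comm] using hz1
  set Sm := (rconnSubsets (boxSystem (G := G) ρ nP).Adj Finset.univ).powerset.filter
    fun 𝒞 => ∑ Y ∈ 𝒞, (Y.card : ℝ) < m with hSm
  set Φ : Finset (Finset (BoxLabel nP)) → ℂ := truncatedWeight (GeomInc (boxSystem (G := G) ρ nP).Adj)
    (connActivity (boxSystem (G := G) ρ nP).Adj (zdHaar 4 G) ((boxSystem (G := G) ρ nP).weight z)) with hΦ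
  -- tail
  have htail := PlaqSystem.norm_pertLogZ_sub_sum_small_le hR hzM hz2 Finset.univ m
  rw [Finset.card_univ, hnP, card_boxLabel_four] at htail
  -- the accumulating rootedness predicates (kept opaque)
  set Q₀ : Finset (Finset (BoxLabel nP)) → Prop := fun _ => True with hQ₀
  set Q₁ : Finset (Finset (BoxLabel nP)) → Prop := fun 𝒞 => BoxRooted 3 m 𝒞 with hQ₁
  set Q₂ : Finset (Finset (BoxLabel nP)) → Prop := fun 𝒞 => BoxRooted 3 m 𝒞 ∧ BoxRooted 2 m 𝒞 with hQ₂
  set Q₃ : Finset (Finset (BoxLabel nP)) → Prop :=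
    fun 𝒞 => (BoxRooted 3 m 𝒞 ∧ BoxRooted 2 m 𝒞) ∧ BoxRooted 1 m 𝒞 with hQ₃
  set Q₄ : Finset (Finset (BoxLabel nP)) → Prop :=
    fun 𝒞 => ∀ j ∈ (Finset.univ : Finset (Fin 4)), BoxRooted j m 𝒞 with hQ₄
  have hsize : ∀ i : Fin 4, 2 * m ≤ nP i := fun i => by rw [hnP, cube_sizes_apply]; exact h2m
  have hPi : ∀ i : Fin 4, ((nP i : ℕ) : ℂ) = (P : ℂ) := fun i => by rw [hnP, cube_sizes_apply]
  have step : ∀ (i : Fin 4) (Q Q' : Finset (Finset (BoxLabel nP)) → Prop) [DecidablePred Q] [DecidablePred Q'],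
      (∀ (s : ℕ) 𝒞, Q (𝒞.image (Finset.image (BoxLabel.rot i s))) ↔ Q 𝒞) →
      (∀ 𝒞, Q' 𝒞 ↔ Q 𝒞 ∧ BoxRooted i m 𝒞) →
      ∑ 𝒞 ∈ Sm with Q 𝒞, Φ 𝒞 = (P : ℂ) * ∑ 𝒞 ∈ Sm with Q' 𝒞, Φ 𝒞 := by
    intro i Q Q' _ _ hQ hQ'
    rw [← hPi i]
    exact sum_small_eq_size_mul_sum_of_iff (G := G) (n := nP) hρ hzM hsmall1 i (hsize i) Q Q' hQ hQ'
  have e3 := step 3 Q₀ Q₁ (fun _ _ => Iff.rfl) (fun 𝒞 => by simp [hQ₀, hQ₁])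
  have e2 := step 2 Q₁ Q₂ (fun s 𝒞 => by
    simp only [hQ₁, boxRooted_rotFamily_iff_of_ne (show (3 : Fin 4) ≠ 2 by decide)])
    (fun 𝒞 => by simp [hQ₁, hQ₂])
  have e1 := step 1 Q₂ Q₃ (fun s 𝒞 => by
    simp only [hQ₂, boxRooted_rotFamily_iff_of_ne (show (3 : Fin 4) ≠ 1 by decide),
      boxRooted_rotFamily_iff_of_ne (show (2 : Fin 4) ≠ 1 by decide)])
    (fun 𝒞 => by simp [hQ₂, hQ₃])
  have e0 := step 0 Q₃ Q₄ (fun s 𝒞 => by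
    simp only [hQ₃, boxRooted_rotFamily_iff_of_ne (show (3 : Fin 4) ≠ 0 by decide),
      boxRooted_rotFamily_iff_of_ne (show (2 : Fin 4) ≠ 0 by decide),
      boxRooted_rotFamily_iff_of_ne (show (1 : Fin 4) ≠ 0 by decide)])
    (fun 𝒞 => by
      simp only [hQ₃, hQ₄, Finset.mem_univ, forall_true_left]
      constructor
      · intro h; exact ⟨⟨⟨h 3, h 2⟩, h 1⟩, h 0⟩
      · rintro ⟨⟨⟨h3, h2⟩, h1⟩, h0⟩ j
        fin_cases j <;> assumption)
  have hchain : ∑ 𝒞 ∈ Sm, Φ 𝒞 = (P : ℂ) ^ 4 * ∑ 𝒞 ∈ Sm with Q₄ 𝒞, Φ 𝒞 := by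
    have e3' : ∑ 𝒞 ∈ Sm, Φ 𝒞 = ∑ 𝒞 ∈ Sm with Q₀ 𝒞, Φ 𝒞 :=
      Finset.sum_congr (Finset.filter_true_of_mem fun _ _ => trivial).symm fun _ _ => rfl
    rw [e3', e3, e2, e1, e0]
    ring
  -- independence of the side
  have hincl : ∑ 𝒞 ∈ ((rconnSubsets (boxSystem (G := G) ρ nr).Adj Finset.univ).powerset.filter
        fun 𝒞 => ∑ Y ∈ 𝒞, (Y.card : ℝ) < m) with ∀ j ∈ (Finset.univ : Finset (Fin 4)), BoxRooted j m 𝒞,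
        truncatedWeight (GeomInc (boxSystem (G := G) ρ nr).Adj)
          (connActivity (boxSystem (G := G) ρ nr).Adj (zdHaar 4 G) ((boxSystem (G := G) ρ nr).weight z)) 𝒞 =
      ∑ 𝒞 ∈ Sm with Q₄ 𝒞, Φ 𝒞 :=
    sum_small_boxRooted_eq_of_le (d := 4) (G := G) hρ (cube_sizes_le hm1) (Finset.univ : Finset (Fin 4))
      (fun i hi => absurd (Finset.mem_univ i) hi) (m := m) (fun i _ => by rw [cube_sizes_apply])
      (cube_sizes_pos (Nat.succ_pos m)) z
  rw [hincl, ← hchain]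
  calc _ ≤ (P * P * P * P * 6 : ℝ) * Real.exp (-(m : ℝ)) := by simpa using htail
    _ = ((P : ℝ) ^ 4 * 6) * Real.exp (-(m : ℝ)) := by ring

end Boxes

end Literature.MathematicalPhysics.QuantumFieldTheory
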